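import Literature.AnabelianGeometry.EtaleTheta.FrobenioidThetaDivisorPrincipal
import Literature.AlgebraicGeometry.Frobenioids.ModelFrobenioidBirational
import Literature.AlgebraicGeometry.Frobenioids.PreFrobenioidDataOfModel
import HarnessLib

/-!
# [EtTh] §5, Prop. 5.3: at MODEL data the printed F1 `principalDivisors` IS «the image of the birational function monoid»
# `Div_B(B(A^bs))` ([FrdI] Thm. 5.2 (ii)) — PROOF-ONLY companion of `FrobenioidThetaDivisorPrincipal.lean` (0 definitions)

S. Mochizuki, *The étale theta function and its Frobenioid-theoretic manifestations*, Publ. RIMS **45** (2009)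
[MochizukiEtTh2009]: Def. 3.6 (ii) p. 303 (PDF p. 77) «the data `(D, Φ, B, B → Φ^gp)` determines a model Frobenioid … a
tempered Frobenioid»; §4 p. 312 (PDF p. 86) «`s′·(s″)⁻¹ ∈ O^×(A^birat)`»; Prop. 5.3 proof p. 326 (PDF p. 100) «the image of
the birational function monoid»; S. Mochizuki, *The geometry of Frobenioids I* [MochizukiFrdI2008]: Thm. 5.2 (i) p. 100
(the model Frobenioid: morphisms `(deg_Fr, Base, Div, u)` subject to `deg_Fr·α + Div = Base^*β + Div_B(u)`), Thm. 5.2 (ii)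
p. 101 («there is a natural isomorphism of functors between the functor `O^×(−)` on `D` associated to the Frobenioid
`C^birat` … and the functor `B`; this isomorphism is compatible with … `Div_B`»).
[cite: MochizukiEtTh2009, Prop 5.3 proof p.326 (PDF p.100)] [cite: MochizukiFrdI2008, Thm. 5.2 (ii) p.101]

Cell abc-iut, layer L2 ([EtTh] §5), seat abc-iut-L6-d1 (gen 5), row «F1-BIRAT» (abc-iut-L2-lead R453 GO 2026-08-26T14:33Z).
WHAT IS PROVED, for `C = ModelFrobenioid Φ B Div_B` with operations `PreFrobenioidData.ofModel Φ B Div_B` (= `𝔉.pre` of the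
assembled §5 data `ofBiKummerData …` / `ofConnectedTemperoidData …` by `rfl`) and an object `X` with `B(X^bs)` group-like
([EtTh] Def. 3.6 (i): `B₀` is a group of log-meromorphic functions; the tree's `RealifiedDivisorMonoids.isUnit_BΛ`):
* `divB_mem_principalGenerators_ofModel` — EVERY `Div_B(b)`, `b ∈ B(X^bs)`, is the divisor of a base-equivalent pair of
  pre-steps out of `X` (write `Div_B(b) = x − y` with `x, y ∈ Φ(X^bs)`; the pre-steps `(1, id, x, 1)` and `(1, id, y, b⁻¹)` into
  `(X^bs, α + x)`, Thm. 5.2 (i));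
* `principalGenerators_ofModel_subset_range_divB` — conversely the divisor of such a pair is `Div_B(s′·(s″)⁻¹)`
  (abc-iut-L2-t9's `divB_frac`);
* `principalDivisors_ofModel_eq` — hence **`principalDivisors (ofModel Φ B Div_B) X = closure (range Div_B)`**, and
  `mem_principalDivisors_ofModel_iff` — **`x` is principal iff `x = Div_B(b)` for some `b ∈ B(X^bs)`**: the F1 datum of
  Prop. 5.3 at model data is print's image of the birational function monoid ([FrdI] Thm. 5.2 (ii)), with no choice left.
HONEST FRAMING: kernel-checked statements about OUR typed model Frobenioid; nothing here asserts a result of [EtTh] for an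
actual curve; typed ≠ proved; no side is taken on [IUTchIII] Cor. 3.12.
-/

namespace Literature.AnabelianGeometry.EtaleTheta

open CategoryTheory Opposite
open Literature.AlgebraicGeometry.Frobenioids

universe w v u

namespace FrobenioidThetaDivisors

variable {D : Type u} [Category.{v} D] {Φ B : Dᵒᵖ ⥤ CommMonCat.{w}} {DivB : B ⟶ monoidGp Φ}

/-- Every element of a Grothendieck group is a fraction `of a / of b`. [folklore] -/
private theorem exists_eq_of_div_of' {M : Type*} [CommMonoid M] (z : Algebra.GrothendieckGroup M) :
    ∃ a b : M, z = Algebra.GrothendieckGroup.of a / Algebra.GrothendieckGroup.of b := by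
  induction z using Localization.induction_on with
  | H y =>
    refine ⟨y.1, y.2, eq_div_iff_mul_eq'.mpr ?_⟩
    rw [Localization.mk_eq_monoidOf_mk'_apply]
    exact Submonoid.LocalizationMap.mk'_spec _ _ _

/-- **Every `Div_B(b)` is the divisor of a base-equivalent pair of pre-steps out of `X`** (`B(X^bs)` group-like): with
`Div_B(b) = x − y`, the pair `(1, id, x, 1), (1, id, y, b⁻¹) : (X^bs, α) → (X^bs, α + x)` of Thm. 5.2 (i).
[cite: MochizukiFrdI2008, Thm. 5.2(i) p.100] [cite: MochizukiEtTh2009, §4 p.312 (PDF p.86)] -/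
theorem divB_mem_principalGenerators_ofModel (X : ModelFrobenioid Φ B DivB) (hB : ∀ b : B.obj (op X.base), IsUnit b)
    (b : B.obj (op X.base)) :
    divB Φ B DivB (op X.base) b ∈ principalGenerators (PreFrobenioidData.ofModel Φ B DivB) X := by
  obtain ⟨x, y, hxy⟩ := exists_eq_of_div_of' (divB Φ B DivB (op X.base) b)
  have hb : divB Φ B DivB (op X.base) ((hB b).unit : B.obj (op X.base)) =
      Algebra.GrothendieckGroup.of x / Algebra.GrothendieckGroup.of y := by
    rw [IsUnit.unit_spec]; exact hxy
  -- the object `(X^bs, α + x)` and the pre-steps `(1, id, x, 1)`, `(1, id, y, b⁻¹)` into it (Thm. 5.2 (i))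
  let Y : ModelFrobenioid Φ B DivB := ⟨X.base, X.cls * Algebra.GrothendieckGroup.of x⟩
  let s : X ⟶ Y :=
    { degFr := 1
      base := 𝟙 X.base
      div := x
      unit := 1
      rel := by
        change X.cls ^ ((1 : ℕ+) : ℕ) * Algebra.GrothendieckGroup.of x =
          pullGp Φ (𝟙 X.base) (X.cls * Algebra.GrothendieckGroup.of x) * divB Φ B DivB _ 1
        rw [PNat.one_coe, pow_one, map_one, mul_one, pullGp_id] }
  let s' : X ⟶ Y :=
    { degFr := 1
      base := 𝟙 X.base
      div := y
      unit := (((hB b).unit⁻¹ : (B.obj (op X.base))ˣ) : B.obj (op X.base))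
      rel := by
        change X.cls ^ ((1 : ℕ+) : ℕ) * Algebra.GrothendieckGroup.of y =
          pullGp Φ (𝟙 X.base) (X.cls * Algebra.GrothendieckGroup.of x) *
            divB Φ B DivB _ (((hB b).unit⁻¹ : (B.obj (op X.base))ˣ) : B.obj (op X.base))
        rw [PNat.one_coe, pow_one, pullGp_id, map_units_inv, hb, inv_div, mul_div, mul_right_comm, mul_div_assoc,
          div_self', mul_one] }
  have hpre : ∀ t : X ⟶ Y, ModelFrobenioid.degFr t = 1 → ModelFrobenioid.baseMap t = 𝟙 X.base →
      (PreFrobenioidData.ofModel Φ B DivB).IsPreStep t := fun t h₁ h₂ => by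
    refine ⟨h₁, ?_⟩
    change IsIso (ModelFrobenioid.baseMap t)
    rw [h₂]
    infer_instance
  exact ⟨Y, s, s', hpre s rfl rfl, hpre s' rfl rfl, rfl, hxy⟩

/-- **Conversely, the divisor of a base-equivalent pair of pre-steps is `Div_B` of the fraction `s′·(s″)⁻¹`**
(abc-iut-L2-t9's `divB_frac`, Thm. 5.2 (ii)). [cite: MochizukiFrdI2008, Thm. 5.2 (ii) p.101] -/
theorem principalGenerators_ofModel_subset_range_divB (X : ModelFrobenioid Φ B DivB)
    (hB : ∀ b : B.obj (op X.base), IsUnit b) :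
    principalGenerators (PreFrobenioidData.ofModel Φ B DivB) X ⊆
      Set.range (divB Φ B DivB (op X.base)) := by
  rintro _ ⟨Y, s, s', hs, hs', hb, rfl⟩
  exact ⟨(ModelFrobenioid.frac hB s s' : B.obj (op X.base)),
    ModelFrobenioid.divB_frac hB s s' hb (hs.1.trans hs'.1.symm)⟩

/-- **At model data the printed F1 is the image of `Div_B`**: `principalDivisors (ofModel Φ B Div_B) X` is the subgroup
generated by `Div_B(B(X^bs))` ([FrdI] Thm. 5.2 (ii): `O^×(−)` of `C^birat` «is» `B`, compatibly with `Div_B`).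
[cite: MochizukiFrdI2008, Thm. 5.2 (ii) p.101] [cite: MochizukiEtTh2009, Prop 5.3 proof p.326 (PDF p.100)] -/
theorem principalDivisors_ofModel_eq (X : ModelFrobenioid Φ B DivB) (hB : ∀ b : B.obj (op X.base), IsUnit b) :
    principalDivisors (PreFrobenioidData.ofModel Φ B DivB) X =
      Subgroup.closure (Set.range (divB Φ B DivB (op X.base))) :=
  le_antisymm (Subgroup.closure_mono (principalGenerators_ofModel_subset_range_divB X hB))
    ((Subgroup.closure_le _).mpr fun _ ⟨b, hb⟩ =>
      hb ▸ Subgroup.subset_closure (divB_mem_principalGenerators_ofModel X hB b))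

/-- **Membership form**: at model data with `B(X^bs)` group-like, `x ∈ Φ(X^bs)^gp` is principal iff `x = Div_B(b)` for some
`b ∈ B(X^bs)` — print's «image of the birational function monoid» on the nose (the image of a group is a subgroup).
[cite: MochizukiFrdI2008, Thm. 5.2 (ii) p.101] [cite: MochizukiEtTh2009, Prop 5.3 proof p.326 (PDF p.100)] -/
theorem mem_principalDivisors_ofModel_iff (X : ModelFrobenioid Φ B DivB) (hB : ∀ b : B.obj (op X.base), IsUnit b)
    (x : Algebra.GrothendieckGroup (Φ.obj (op X.base))) :
    x ∈ principalDivisors (PreFrobenioidData.ofModel Φ B DivB) X ↔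
      ∃ b : B.obj (op X.base), divB Φ B DivB (op X.base) b = x := by
  constructor
  · intro hx
    rw [principalDivisors_ofModel_eq X hB] at hx
    induction hx using Subgroup.closure_induction with
    | mem _ h => exact h
    | one => exact ⟨1, map_one _⟩
    | mul _ _ _ _ h₁ h₂ =>
      obtain ⟨b₁, rfl⟩ := h₁
      obtain ⟨b₂, rfl⟩ := h₂
      exact ⟨b₁ * b₂, map_mul _ _ _⟩
    | inv _ _ h =>
      obtain ⟨b, rfl⟩ := h
      exact ⟨(((hB b).unit⁻¹ : (B.obj (op X.base))ˣ) : B.obj (op X.base)), by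
        rw [map_units_inv, IsUnit.unit_spec]⟩
  · rintro ⟨b, rfl⟩
    exact Subgroup.subset_closure (divB_mem_principalGenerators_ofModel X hB b)

end FrobenioidThetaDivisors

end Literature.AnabelianGeometry.EtaleTheta
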